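import Summits.QuantumFields.YangMills.Theorems.LuscherReductionTwistedTraceScalingBTFixedBeta
import Summits.QuantumFields.YangMills.Theorems.LuscherReductionTwistedTraceScalingBTCoreFloor
import Summits.QuantumFields.YangMills.Theorems.LuscherReductionTwistedTraceScalingBTTopValue
import HarnessLib

/-!
# The ABSOLUTE TAIL BUDGET at fixed `β`: `btTau ≤ κ₂·btC·λ₀(L³β)` from the RELATIVE floor (no lower bound on the fibre law)
# (lane A of S-BASE, crux `TwistedTraceScaling` stmt-QuantumFields-20203, C4-CORE, the (B-T) pen; design note `pub/ym-fleet/ym-luscher-20007-p1/COARSE-DESIGN.md` §25.9 (hτZ))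

The door `…BTPointwiseTail.hT_of_fp_add` needs `τ/Z ≤ κ₂·(C/Z)·λ₀(L³β)`.  Both `τ` (the tails, `…BTFixedBeta.btTau`) and `C·K₁(1,1) = fpBOKernel(coreWeight)(1,1)` carry the SAME factor
`(∫Ω dπ)²`: `C·e^{2β|E|} ≥ e^{2β|E|}e^{−βM₀}·Haar^Λ(G_c(ρ))·(∫Ω dπ)²` (`…BTCoreFloor.fpBOKernel_one_one_ge` with `coreWeight ≥ 𝟙_{G_c(ρ)}`), so the budget reduces to three explicit
exponential inequalities and the one-site floor `λ₀(B) ≥ e^{6B}·e^{−3}B^{−9/2}/2000` (`…BTTopValue`), using `2|E| = 6L³` (`card_edge_three`).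
* `card_site_cube`, `card_edge_three`; `coreWeight_ge_one_of_mem_gaugeCore` (`2ρ < R₁`, `2ρ < ε`, `ρ < 1`);
* ★★★ `btTau_le` — `btTau ≤ κ₂·btC·levelValue su2Rep 1 (L³β) 0` under (H1)–(H3):
  `e^{βM₀}e^{−β m_nt} ≤ (κ₂/3)·Haar^Λ(G_c)·ℓ(B)`, the same for `m_far`, and `e^{−L³β·α²} ≤ (κ₂/3)·ℓ(B)`, `ℓ(B) = e^{−3}B^{−9/2}/2000`.
HONEST FRAMING: bookkeeping for a stub of a child of the CONDITIONAL reduction route R2b1; the β-schedule making (H1)–(H3) and the smallness hypotheses of `fixed_beta_estimate` hold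
eventually is the last missing piece of (B-T); C4-CORE OPEN; not infinite volume, not a gap, not Clay.
-/

set_option autoImplicit false

noncomputable section

open MeasureTheory Filter Topology Real
open scoped BigOperators Matrix Quaternion
open Literature.MathematicalPhysics.QuantumFieldTheory
open Literature.MathematicalPhysics.QuantumLattice

namespace Summit.QuantumFields.YangMills.Theorems.FemtoTransferGap.TwoLattice.ConstTube

open Summit.QuantumFields.YangMills.Theorems.FemtoTransferGap
open Summit.QuantumFields.YangMills.Theorems.FemtoTransferGap.TwoLattice
open Summit.QuantumFields.YangMills.Theorems.FemtoTransferGap.TwoLattice.Avg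
open Summit.QuantumFields.YangMills.Theorems.FemtoTransferGap.TwoLattice.Stiff (LinkSpace)
open Summit.QuantumFields.YangMills.Theorems.FemtoTransferGap.TwoLattice.Cov

variable {L : ℕ} [NeZero L]

/-! ## §1 Counting -/

variable (L) in
/-- `|Site 3 L| = L³`. [folklore] -/
theorem card_site_cube : (Fintype.card (Site 3 L) : ℝ) = (L : ℝ) ^ 3 := by
  rw [Fintype.card_pi, Finset.prod_const, Finset.card_univ, Fintype.card_fin, ZMod.card]; push_cast; ring

variable (L) in
/-- `|Edge 3 L| = 3L³`. [folklore] -/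
theorem card_edge_three : (Fintype.card (Edge 3 L) : ℝ) = 3 * (L : ℝ) ^ 3 := by
  rw [show (Fintype.card (Edge 3 L) : ℝ) = (Fintype.card (Site 3 L × Fin 3) : ℝ) from rfl, Fintype.card_prod, Nat.cast_mul, card_site_cube, Fintype.card_fin]
  push_cast; ring

/-- `e^{β·2|E|} = e^{6L³β}`. [folklore] -/
theorem exp_two_card_edge (β : ℝ) : Real.exp (β * (2 * (Fintype.card (Edge 3 L) : ℝ))) = Real.exp (6 * ((L : ℝ) ^ 3 * β)) := by
  rw [card_edge_three]; ring_nf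

/-! ## §2 The quaternion core carries full core weight -/

/-- On `G_c(ρ)` with `2ρ < R₁`, `2ρ < ε`, `ρ < 1` the core weight equals `1`. [folklore] -/
theorem coreWeight_ge_one_of_mem_gaugeCore {ρ R₁ ε : ℝ} (hρR : 2 * ρ < R₁) (hρε : 2 * ρ < ε) (hρ1 : ρ < 1) {g : Site 3 L → SU2} (hg : g ∈ gaugeCore L ρ) :
    1 ≤ coreWeight L ε R₁ g := by
  have hcore : g ∈ coreSet L R₁ := mem_coreSet_of_forall_norm_sub_one_le hρR hg
  have hball := colourMean_mem_fpBall_of_mem_gaugeCore (L := L) hρ1 hρε hg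
  unfold coreWeight fpWeight
  rw [Set.indicator_of_mem hcore, Set.indicator_of_mem hball]

/-! ## §3 ★★★ The tail budget -/

/-- ★★★ **`τ ≤ κ₂·C·λ₀(L³β)`** from three explicit exponential inequalities. [cite: Luscher1983, §3] -/
theorem btTau_le {β : ℝ} (hβ : 0 ≤ β) (hB1 : 1 ≤ (L : ℝ) ^ 3 * β) (hB2 : 2 / rStar ^ 3 ≤ (L : ℝ) ^ 3 * β)
    {Ω : LinkSpace L → ℝ} (hΩm : Measurable Ω) (hΩ1 : ∀ x, |Ω x| ≤ 1) (hΩ0 : ∀ x, 0 ≤ Ω x) {δ α t R R₁ ε P₀ ρ κ₂ : ℝ}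
    (hΩt : ∀ v : Edge 3 L → Fin 3 → ℝ, Ω (linkEmbed L v) ≠ 0 → (∀ (e : Edge 3 L) (c : Fin 3), |v e c| ≤ t) ∧ ‖linkEmbed L v‖ ≤ R)
    (ht : t ≤ 1 / 30) (hρ0 : 0 ≤ ρ) (hρR : 2 * ρ < R₁) (hρε : 2 * ρ < ε) (hρ1 : ρ < 1) (hκ₂ : 0 ≤ κ₂)
    (H1 : Real.exp (β * ((Fintype.card (Edge 3 L) : ℝ) * (2 * ρ + 2 * Real.sqrt 2 * R) ^ 2) + β * ((10 * Real.sqrt (Fintype.card (Plaquette 3 L × Fin 3)) * R) ^ 2 +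
        stepActionErr (L := L) t 0)) * Real.exp (-(β * btMnt L δ α R R₁ ε)) ≤
        κ₂ / 3 * (gaugeMeasure L).real (gaugeCore L ρ) * (Real.exp (-3) * ((L : ℝ) ^ 3 * β) ^ (-(9 : ℝ) / 2) / 2000))
    (H2 : Real.exp (β * ((Fintype.card (Edge 3 L) : ℝ) * (2 * ρ + 2 * Real.sqrt 2 * R) ^ 2) + β * ((10 * Real.sqrt (Fintype.card (Plaquette 3 L × Fin 3)) * R) ^ 2 +
        stepActionErr (L := L) t 0)) * Real.exp (-(β * btMfar L δ α R ε P₀)) ≤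
        κ₂ / 3 * (gaugeMeasure L).real (gaugeCore L ρ) * (Real.exp (-3) * ((L : ℝ) ^ 3 * β) ^ (-(9 : ℝ) / 2) / 2000))
    (H3 : Real.exp (-((L : ℝ) ^ 3 * β * α ^ 2)) ≤ κ₂ / 3 * (Real.exp (-3) * ((L : ℝ) ^ 3 * β) ^ (-(9 : ℝ) / 2) / 2000)) :
    btTau L β Ω δ α R R₁ ε P₀ (btC L β Ω ε R₁) ≤ κ₂ * btC L β Ω ε R₁ * levelValue su2Rep 1 ((L : ℝ) ^ 3 * β) 0 := by
  set B : ℝ := (L : ℝ) ^ 3 * β with hBdef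
  set ℓ : ℝ := Real.exp (-3) * B ^ (-(9 : ℝ) / 2) / 2000 with hℓ
  set hG : ℝ := (gaugeMeasure L).real (gaugeCore L ρ) with hhG
  set I : ℝ := ∫ v, Ω (linkEmbed L v) ∂orthoTransverse L with hI
  set M₀ : ℝ := β * ((Fintype.card (Edge 3 L) : ℝ) * (2 * ρ + 2 * Real.sqrt 2 * R) ^ 2) + β * ((10 * Real.sqrt (Fintype.card (Plaquette 3 L × Fin 3)) * R) ^ 2 +
    stepActionErr (L := L) t 0) with hM₀
  set C : ℝ := btC L β Ω ε R₁ with hC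
  have hB0 : 0 < B := by linarith
  have hℓ0 : 0 < ℓ := by positivity
  have hlam : Real.exp (6 * B) * ℓ ≤ levelValue su2Rep 1 B 0 := levelValue_one_site_zero_ge hB1 hB2
  have hK1 : transferKernel su2Rep B (1 : GaugeConfig 3 1 SU2) 1 = Real.exp (β * (2 * (Fintype.card (Edge 3 L) : ℝ))) := transferKernel_one_site_one_one_cube (L := L) β
  have hE6 : Real.exp (β * (2 * (Fintype.card (Edge 3 L) : ℝ))) = Real.exp (6 * B) := exp_two_card_edge (L := L) β
  have hWc := measurable_coreWeight (L := L) ε R₁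
  -- the relative floor: `e^{2β|E|}·e^{−M₀}·hG·I² ≤ fp_core(1,1) = C·e^{2β|E|}`
  have hfloor := fpBOKernel_one_one_ge hβ hΩm hΩ1 hΩ0 hWc (abs_coreWeight_le ε R₁) (fun g => (coreWeight_mem_Icc ε R₁ g).1) hρ0 ht
    (fun g hg => coreWeight_ge_one_of_mem_gaugeCore hρR hρε hρ1 hg) hΩt
  have hCeq : fpBOKernel L β Ω (coreWeight L ε R₁) 1 1 = C * Real.exp (6 * B) := by
    rw [hC, btC, ← hBdef, hK1, hE6, div_mul_cancel₀ _ (Real.exp_pos _).ne']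
  have hexp_split : Real.exp (β * (2 * (Fintype.card (Edge 3 L) : ℝ)) - β * ((Fintype.card (Edge 3 L) : ℝ) * (2 * ρ + 2 * Real.sqrt 2 * R) ^ 2) -
      β * ((10 * Real.sqrt (Fintype.card (Plaquette 3 L × Fin 3)) * R) ^ 2 + stepActionErr (L := L) t 0)) = Real.exp (6 * B) * Real.exp (-M₀) := by
    rw [← hE6, ← Real.exp_add]; congr 1; rw [hM₀]; ring
  rw [hexp_split, hCeq] at hfloor
  -- so `hG·I² ≤ C·e^{M₀}`
  have hGI : hG * I ^ 2 ≤ C * Real.exp M₀ := by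
    have h6 : 0 < Real.exp (6 * B) := Real.exp_pos _
    have hm : 0 < Real.exp (-M₀) := Real.exp_pos _
    have h1 : Real.exp (-M₀) * (hG * I ^ 2) ≤ C := by
      have := hfloor; rw [← hhG, ← hI] at this
      refine le_of_mul_le_mul_left (?_ : Real.exp (6 * B) * (Real.exp (-M₀) * (hG * I ^ 2)) ≤ Real.exp (6 * B) * C) h6
      linarith [this]
    calc hG * I ^ 2 = Real.exp M₀ * (Real.exp (-M₀) * (hG * I ^ 2)) := by rw [← mul_assoc, ← Real.exp_add, add_neg_cancel, Real.exp_zero, one_mul]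
      _ ≤ Real.exp M₀ * C := mul_le_mul_of_nonneg_left h1 (Real.exp_pos _).le
      _ = C * Real.exp M₀ := mul_comm _ _
  have hC0 : 0 ≤ C := by
    rw [hC]; unfold btC
    exact div_nonneg (fpBOKernel_nonneg β hΩm hΩ1 hΩ0 hWc (abs_coreWeight_le ε R₁) (fun g => (coreWeight_mem_Icc ε R₁ g).1) 1 1) (transferKernel_pos _ _ _ _).le
  have hG0 : 0 ≤ hG := by rw [hhG]; exact measureReal_nonneg
  -- the three pieces
  have piece : ∀ m : ℝ, Real.exp M₀ * Real.exp (-(β * m)) ≤ κ₂ / 3 * hG * ℓ →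
      Real.exp (6 * B) * Real.exp (-(β * m)) * I ^ 2 ≤ κ₂ / 3 * C * (Real.exp (6 * B) * ℓ) := by
    intro m hm
    have h6 : 0 ≤ Real.exp (6 * B) := (Real.exp_pos _).le
    -- `hG·(e^{6B}e^{−βm}I²) ≤ e^{6B}e^{−βm}·C·e^{M₀} ≤ … `; divide the `hG` out via `hm`
    by_cases hG00 : hG = 0
    · -- then `I² ≤ C e^{M₀}/hG` is unavailable, but `hm` forces `e^{M₀}e^{−βm} ≤ 0`, impossible unless… : use `hm` directly
      have : Real.exp M₀ * Real.exp (-(β * m)) ≤ 0 := by rw [hG00] at hm; simpa using hm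
      exact absurd this (not_le.mpr (mul_pos (Real.exp_pos _) (Real.exp_pos _)))
    have hGpos : 0 < hG := lt_of_le_of_ne hG0 (Ne.symm hG00)
    have h1 : Real.exp (-(β * m)) * I ^ 2 ≤ κ₂ / 3 * C * ℓ := by
      have h2 : hG * (Real.exp (-(β * m)) * I ^ 2) ≤ hG * (κ₂ / 3 * C * ℓ) := by
        calc hG * (Real.exp (-(β * m)) * I ^ 2) = Real.exp (-(β * m)) * (hG * I ^ 2) := by ring
          _ ≤ Real.exp (-(β * m)) * (C * Real.exp M₀) := mul_le_mul_of_nonneg_left hGI (Real.exp_pos _).le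
          _ = C * (Real.exp M₀ * Real.exp (-(β * m))) := by ring
          _ ≤ C * (κ₂ / 3 * hG * ℓ) := mul_le_mul_of_nonneg_left hm hC0
          _ = hG * (κ₂ / 3 * C * ℓ) := by ring
      exact le_of_mul_le_mul_left h2 hGpos
    linarith [mul_le_mul_of_nonneg_left h1 h6]
  have p1 := piece _ H1
  have p2 := piece _ H2
  have p3 : C * Real.exp ((L : ℝ) ^ 3 * β * (6 - α ^ 2)) ≤ κ₂ / 3 * C * (Real.exp (6 * B) * ℓ) := by
    have e : Real.exp ((L : ℝ) ^ 3 * β * (6 - α ^ 2)) = Real.exp (6 * B) * Real.exp (-((L : ℝ) ^ 3 * β * α ^ 2)) := by rw [← Real.exp_add]; congr 1; rw [hBdef]; ring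
    rw [e]
    have := mul_le_mul_of_nonneg_left H3 (mul_nonneg hC0 (Real.exp_pos (6 * B)).le)
    linarith [this]
  have hsum : btTau L β Ω δ α R R₁ ε P₀ C ≤ κ₂ * C * (Real.exp (6 * B) * ℓ) := by
    unfold btTau
    rw [hE6, ← hI]
    linarith [p1, p2, p3]
  exact hsum.trans (mul_le_mul_of_nonneg_left hlam (mul_nonneg hκ₂ hC0))

end Summit.QuantumFields.YangMills.Theorems.FemtoTransferGap.TwoLattice.ConstTube

end
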